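import Summits.BirchSwinnertonDyer.Rank1Residual.Additive.X4RankZeroKatoBoundSharp
import Summits.BirchSwinnertonDyer.Rank1Residual.AdditivePotMult.RankZeroChiBranchPrimeFacts
import Literature.NumberTheory.EllipticCurves.PastenValuationProductThm115Proofs
import Literature.NumberTheory.EllipticCurves.TamagawaNeZeroProofs
import HarnessLib

/-!
# X4 ∧ `r_an = 0` at EVERY ODD PRIME: the upper half `ord_p #Ш ≤ ord_p #Ш_an` on the COVERED LOCUS
# [`ord_p j < 0` ∨ (tower surjectivity ∧ `ord_p ∏ c_ℓ = ord_p c_p` ∧ Manin datum)] from five named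
# published facts, and the chain of record `BSD(E,p)` on its `p ∤ #Ш_an` rows
# (cell `b2b-bsdres`, seat additive-p4, line V22 part 1; part 2 = `Additive/X4SharpUnitFreeResidue.lean`)

HONEST FRAMING (cell `b2b-bsdres`, run/shared/lean/b2b/bsd-rank1-residual/, verbatim in every
file): the goal of the cell is to DELETE the COMBINATION-SHAPED residual classes of the
Birch–Swinnerton-Dyer formula for ALL analytic-rank `≤ 1` elliptic curves over `ℚ` — "full BSD
formula for every rank `≤ 1` curve in class `C`" assembled STRICTLY from published theorems — so
that the rank-`≤ 1` remainder becomes exactly the CONSTRUCTION-SHAPED classes, which are TYPED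
(missing-input `Prop`s), NOT attempted. This is not "finishing BSD". Sub-cell additive-p4 (X3♯/X4♯
direct): research route on the CONSTRUCTION-SHAPED class X4; no claim beyond the stated classes;
the label X4 is UNCHANGED by this file; nothing is booked. Theorems only (no definition, no named
fact minted; every published input is an explicit named-fact hypothesis of the tree).

## What this file proves

The rank-`0` upper half of X4♯ was reached prime by prime and cell by cell: Kim 2026 Thm. 1.8 (6) at
`p ≥ 5` (`X4RankZeroUpperBound`, Manin datum, Tamagawa slack), Kato 2004 Thm. 14.5 (3) +
Prop. 14.16 (2) at a potentially good `p ≥ 3` (V20/V20♯: `X4RankZeroKatoBound[Sharp]`, tower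
surjectivity, binder `ord_p ∏ c_ℓ = ord_p c_p`), and seat additive-p1's `ω^{(p−1)/2}`-branch route at
a potentially multiplicative odd `p` (`AdditivePotMult/RankZeroChiBranchPrimeFacts`: NO Tamagawa,
NO Manin). This file SUMS them into ONE theorem over ALL odd `p`:

* §0 two kernel levers at `p ≥ 5`: **`p ∤ c_p(E)` at an additive `p ≥ 5`** (Kodaira–Néron
  `c_p ≤ 4`: tree theorems `localTamagawaNumber_padic_le_four` + `localTamagawaNumber_padic_ne_zero_holds`),
  so the sharp Kato binder reads `p ∤ ∏ c_ℓ` there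
  (`padicValNat_tamagawaProduct_eq_local_iff_not_dvd_of_addv`); and Serre's lifting
  (`serre_hasSurjectiveModNGaloisRep_pow_holds`: surj(p) ⇒ `ρ̄_{E,p^n}` onto ∀ `n` at `p ≥ 5`), so
  on X4 the tower can fail only at `p = 3` (`towerSurj_of_surj_of_ne_three`).
* §1 **`X4RankZero.missingUpperBoundAt_of_facts`**: X4 ∧ `r_an = 0` ∧ surj(p) ∧ [`ord_p j < 0` ∨
  (`ρ̄_{E,p^n}` onto ∀ `n` ∧ `ord_p ∏ c_ℓ = ord_p c_p` ∧ ∃ modular parametrisation datum with Manin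
  constant prime to `p`)] ⟹ `ord_p #Ш(E) ≤ ord_p #Ш_an(E)`, from FIVE named facts — the sharp Kato
  reading A161 `Kato2004.rankZero_padicValNat_sha_le_sub_localTamagawa_…` (`hKatoS`), Delbourgo 1998
  Prop. 4 (`hDel`), modular parametrisation data (`hmodD`), Wuthrich 2014 Lemma 20 (`hL20`), Kato's
  divisibility on the `ω^{(p−1)/2}`-component over `ℚ(μ_{p^∞})`
  `Wuthrich2014.kato_halfEigenCharIdeal_dvd_cyclotomicPrime_of_surjective` (`hKatoχ`) — + GZK +
  modularity. At `p ≥ 5` the certificate part is just `p ∤ ∏ c_ℓ ∧` Manin datum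
  (`…_of_facts_of_five_le`; `…_of_katoSharp_of_five_le` = Kim's reach on the potentially good rows,
  from the Kato reading; Kim 2026 is not needed on X4 ∧ `r_an = 0`).
* §2 on the covered locus the typed X4 input is EXACTLY the lower half
  (`X4RankZero.missingPPartAt_iff_lower_of_facts`); `BSD(E,p)` from the lower half
  (`X4RankZero.bsdp_of_facts_of_lower`) and on the `p ∤ #Ш_an` rows
  (**`X4RankZero.bsdp_of_facts_of_shaAn_unit`** — the cell's chain of record for X4 ∧ `r = 0` at
  every odd `p`: at `p = 3` it specialises to `X4RankZero.bsdp_three_of_cert_of_shaAn_unit_sharp` of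
  `X4SharpThreeResidue` once the tower is fed by a `j`-witness / (ram) / surj(9) certificate; at
  `p ≥ 5` to `…_of_five_le`).

What is NOT covered (and is typed in part 2 as the residue of X4♯(unit-free)): the LOWER half on the
`p ∣ #Ш_an` rows; the upper half on the potentially good rows with an exotic `3`-adic image
(`p = 3`), with a Tamagawa defect `ord_p ∏ c_ℓ ≠ ord_p c_p`, or without a Manin datum prime to `p`;
rank `1`; the non-surjective rows. X4 stays CONSTRUCTION-SHAPED; nothing booked.

References: Kato 2004 [Kato2004Asterisque] Thm. 14.5 (3), Prop. 14.16 (2), Thm. 17.4 (3), (12.5.2);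
Kim 2026 [Kim2022StructureSelmer] Thm. 1.9 (6), §3.2.3; Delbourgo 1998 [Delbourgo1998] Prop. 4;
Wuthrich 2014 [Wuthrich2014] Lemma 20, Cor. 19; Serre 1972 [Serre1972] IV §3.4; Silverman *ATAEC*
Cor. IV.9.2 (d) [SilvermanATAEC1994]; Miller 2011 [Miller2011LMS] Def. 1.1; SHARPENED-CONJECTURES §4.
-/

noncomputable section

open scoped Classical

open WeierstrassCurve Literature.NumberTheory.EllipticCurves
  Literature.NumberTheory.EllipticCurves.ModularForms
  Literature.NumberTheory.EllipticCurves.Rank1Residual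
  Literature.NumberTheory.EllipticCurves.Rank1Residual.Typed

namespace Summit.BirchSwinnertonDyer.Rank1Residual.Additive

variable (W : WeierstrassCurve ℚ) [W.IsElliptic] [W.IsGloballyMinimal] (p : ℕ) [hp : Fact p.Prime]

/-! ### §0 Two kernel levers at `p ≥ 5` -/

omit [W.IsGloballyMinimal] in
/-- **`p ∤ c_p(E)` at an ADDITIVE prime `p ≥ 5`** (Kodaira–Néron: `c_p ≤ 4` unless the reduction is
split multiplicative — tree theorem `localTamagawaNumber_padic_le_four` (Silverman *ATAEC*
Cor. IV.9.2 (d)); `c_p ≠ 0` by `localTamagawaNumber_padic_ne_zero_holds`), for the `ℤ_p`-local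
Tamagawa number of `E/ℚ_p` that the sharp Kato reading subtracts.
[cite: SilvermanATAEC1994, Cor. IV.9.2 (d) (PDF p. 340)] -/
theorem padicValNat_localTamagawaNumber_padic_eq_zero_of_addv (hadd : Addv W p) (hp5 : 5 ≤ p) :
    padicValNat p ((W.baseChange ℚ_[p]).localTamagawaNumber ℤ_[p]) = 0 := by
  have hns : ¬ ((W.baseChange ℚ_[p]).minimal ℤ_[p]).HasSplitMultiplicativeReduction ℤ_[p] :=
    fun hs ↦ hadd.2 hs.toHasMultiplicativeReduction
  have h4 := localTamagawaNumber_padic_le_four p (W.baseChange ℚ_[p]) hns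
  have h0 := localTamagawaNumber_padic_ne_zero_holds p (W.baseChange ℚ_[p])
  refine padicValNat.eq_zero_of_not_dvd fun h ↦ h0 ?_
  exact Nat.eq_zero_of_dvd_of_lt h (by omega)

omit [W.IsGloballyMinimal] in
/-- At an additive `p ≥ 5` the sharp binder `ord_p ∏ c_ℓ = ord_p c_p` is `p ∤ ∏ c_ℓ`.
[cite: SilvermanATAEC1994, Cor. IV.9.2 (d) (PDF p. 340)] -/
theorem padicValNat_tamagawaProduct_eq_local_iff_not_dvd_of_addv (hadd : Addv W p) (hp5 : 5 ≤ p) :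
    padicValNat p W.tamagawaProduct =
        padicValNat p ((W.baseChange ℚ_[p]).localTamagawaNumber ℤ_[p]) ↔
      ¬ p ∣ W.tamagawaProduct := by
  rw [padicValNat_localTamagawaNumber_padic_eq_zero_of_addv W p hadd hp5]
  have hc0 : W.tamagawaProduct ≠ 0 := (W.tamagawaProduct_pos_holds).ne'
  constructor
  · intro h hdvd
    have := one_le_padicValNat_of_dvd hc0 hdvd
    omega
  · exact padicValNat.eq_zero_of_not_dvd

omit [W.IsElliptic] [W.IsGloballyMinimal] in
/-- On class X4 the prime is `3` or at least `5`. [folklore] -/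
theorem eq_three_or_five_le_of_classX4 (hX : ClassX4 W p) : p = 3 ∨ 5 ≤ p := by
  by_cases h3 : p = 3
  · exact Or.inl h3
  · exact Or.inr (hp.out.five_le_of_ne_two_of_ne_three hX.1 h3)

omit [W.IsGloballyMinimal] in
/-- **Tower surjectivity is automatic on X4 away from `3`**: surj(p) ∧ `p ≠ 3` on an X4 pair ⟹
`ρ̄_{E,p^n}` onto for all `n` (Serre's lifting lemma, tree theorem
`serre_hasSurjectiveModNGaloisRep_pow_holds`, `p ≥ 5`). [cite: Serre1972, IV §3.4 Lemme 3 (p. IV-23)] -/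
theorem towerSurj_of_surj_of_ne_three (hX : ClassX4 W p) (hsurj : Surj W p) (h3 : p ≠ 3) :
    ∀ n : ℕ, W.HasSurjectiveModNGaloisRep (p ^ n : ℕ) :=
  serre_hasSurjectiveModNGaloisRep_pow_holds W p (hp.out.five_le_of_ne_two_of_ne_three hX.1 h3) hsurj

/-! ### §1 The upper half on the covered locus, every odd `p` -/

/-- **The sharp Kato route at `p ≥ 5`**: X4 ∧ `r_an = 0` ∧ `ord_p j ≥ 0` ∧ surj(p) ∧ `p ∤ ∏ c_ℓ` ∧
a datum `D` with `p ∤ c_D` ⟹ `MissingUpperBoundAt W p` — tower surjectivity by Serre (§0), the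
local term `v_p(c_p) = 0` by Kodaira–Néron (§0). Same reach as Kim 2026 Thm. 1.8 (6) on these rows
(`X4RankZero.missingUpperBoundAt`), from the Kato reading instead.
[cite: Kato2004Asterisque, Thm. 14.5 (3) (p. 236), Prop. 14.16 (2) (p. 244)]
[cite: Kim2022StructureSelmer, §3.2.3 display before Thm. 3.7 (PDF p. 16)] [cite: Miller2011LMS, Def. 1.1] -/
theorem X4RankZero.missingUpperBoundAt_of_katoSharp_of_five_le
    (hKatoS : Kato2004.rankZero_padicValNat_sha_le_sub_localTamagawa_of_additive_potGood_of_imageContainsSL2)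
    (hGZK : rank_eq_analyticRank_of_analyticRank_le_one) (hmod : hasEntireLFunction_rat)
    (hp5 : 5 ≤ p) (hr : W.analyticRank = 0) (hX : ClassX4 W p) (hpot : 0 ≤ padicValRat p W.j)
    (hsurj : Surj W p) (htam : ¬ p ∣ W.tamagawaProduct)
    {N : ℕ} [NeZero N] (D : ModularParametrizationData W N) (hc : ¬ (p : ℤ) ∣ D.maninConstant) :
    MissingUpperBoundAt W p :=
  X4RankZero.missingUpperBoundAt_of_katoSharp W p hKatoS hGZK hmod hr hX hpot
    (serre_hasSurjectiveModNGaloisRep_pow_holds W p hp5 hsurj)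
    ((padicValNat_tamagawaProduct_eq_local_iff_not_dvd_of_addv W p hX.2.1 hp5).mpr htam) D hc

/-- **THE UPPER HALF ON THE COVERED LOCUS, every odd `p`**: X4 ∧ `r_an = 0` ∧ surj(p) ∧
[`ord_p j < 0` ∨ (`ρ̄_{E,p^n}` onto ∀ `n` ∧ `ord_p ∏ c_ℓ = ord_p c_p` ∧ ∃ datum `D` with `p ∤ c_D`)]
⟹ `ord_p #Ш(E) ≤ ord_p #Ш_an(E)` — on a potentially multiplicative row by additive-p1's
`ω^{(p−1)/2}`-branch theorem `AdditivePotMult.ClassX4M.missingUpperBoundAt_rankZero_of_surj`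
(Delbourgo 1998 Prop. 4 `hDel`, modular parametrisation data `hmodD`, Wuthrich 2014 Lemma 20
`hL20`, Kato's half-eigen divisibility `hKatoχ`; NO Tamagawa, NO Manin), on a potentially good row by
the sharp Kato reading `hKatoS` (`X4RankZero.missingUpperBoundAt_of_katoSharp`). GZK `hGZK`,
modularity `hmod`. [cite: Kato2004Asterisque, Thm. 14.5 (3) (p. 236), Thm. 17.4 (3) (p. 273)]
[cite: Delbourgo1998, Prop. 4 (p. 144)] [cite: Wuthrich2014, Lemma 20 (p. 399), Cor. 19 (p. 398)]
[cite: Miller2011LMS, Def. 1.1] -/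
theorem X4RankZero.missingUpperBoundAt_of_facts
    (hKatoS : Kato2004.rankZero_padicValNat_sha_le_sub_localTamagawa_of_additive_potGood_of_imageContainsSL2)
    (hDel : Delbourgo1998.prop4_rankZero_pow_dvd_constantCoeff)
    (hGZK : rank_eq_analyticRank_of_analyticRank_le_one) (hmod : hasEntireLFunction_rat)
    (hmodD : nonempty_modularParametrizationData)
    (hL20 : Wuthrich2014.lemma20_surjective_threeAdic_of_semistable)
    (hKatoχ : Wuthrich2014.kato_halfEigenCharIdeal_dvd_cyclotomicPrime_of_surjective)
    (hr : W.analyticRank = 0) (hX : ClassX4 W p) (hsurj : Surj W p)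
    (hcov : padicValRat p W.j < 0 ∨
      ((∀ n : ℕ, W.HasSurjectiveModNGaloisRep (p ^ n : ℕ)) ∧
        padicValNat p W.tamagawaProduct =
          padicValNat p ((W.baseChange ℚ_[p]).localTamagawaNumber ℤ_[p]) ∧
        ∃ (N : ℕ) (_ : NeZero N) (D : ModularParametrizationData W N), ¬ (p : ℤ) ∣ D.maninConstant)) :
    MissingUpperBoundAt W p := by
  by_cases hj : padicValRat p W.j < 0
  · exact AdditivePotMult.ClassX4M.missingUpperBoundAt_rankZero_of_surj hDel hGZK hmod hmodD hL20
      hKatoχ ⟨hX, hX.2.1, hj⟩ hr hsurj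
  · obtain ⟨htower, htam, N, hN, D, hc⟩ := hcov.resolve_left hj
    haveI := hN
    exact X4RankZero.missingUpperBoundAt_of_katoSharp W p hKatoS hGZK hmod hr hX (not_lt.mp hj)
      htower htam D hc

/-- **The covered locus at `p ≥ 5` needs neither tower nor local-Tamagawa certificate**:
X4 ∧ `r_an = 0` ∧ surj(p) ∧ [`ord_p j < 0` ∨ (`p ∤ ∏ c_ℓ` ∧ ∃ datum with `p ∤ c_D`)] ⟹ the upper
half (§0: Serre; `c_p ≤ 4`). [cite: Kato2004Asterisque, Thm. 14.5 (3) (p. 236)]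
[cite: Delbourgo1998, Prop. 4 (p. 144)] [cite: Serre1972, IV §3.4] [cite: Miller2011LMS, Def. 1.1] -/
theorem X4RankZero.missingUpperBoundAt_of_facts_of_five_le
    (hKatoS : Kato2004.rankZero_padicValNat_sha_le_sub_localTamagawa_of_additive_potGood_of_imageContainsSL2)
    (hDel : Delbourgo1998.prop4_rankZero_pow_dvd_constantCoeff)
    (hGZK : rank_eq_analyticRank_of_analyticRank_le_one) (hmod : hasEntireLFunction_rat)
    (hmodD : nonempty_modularParametrizationData)
    (hL20 : Wuthrich2014.lemma20_surjective_threeAdic_of_semistable)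
    (hKatoχ : Wuthrich2014.kato_halfEigenCharIdeal_dvd_cyclotomicPrime_of_surjective)
    (hp5 : 5 ≤ p) (hr : W.analyticRank = 0) (hX : ClassX4 W p) (hsurj : Surj W p)
    (hcov : padicValRat p W.j < 0 ∨
      (¬ p ∣ W.tamagawaProduct ∧
        ∃ (N : ℕ) (_ : NeZero N) (D : ModularParametrizationData W N), ¬ (p : ℤ) ∣ D.maninConstant)) :
    MissingUpperBoundAt W p := by
  refine X4RankZero.missingUpperBoundAt_of_facts W p hKatoS hDel hGZK hmod hmodD hL20 hKatoχ hr hX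
    hsurj (hcov.imp_right fun ⟨htam, hD⟩ ↦ ⟨serre_hasSurjectiveModNGaloisRep_pow_holds W p hp5 hsurj,
      (padicValNat_tamagawaProduct_eq_local_iff_not_dvd_of_addv W p hX.2.1 hp5).mpr htam, hD⟩)

/-! ### §2 On the covered locus the typed input is EXACTLY the lower half; `BSD(E,p)` -/

/-- **X4 ∧ `r_an = 0` ∧ surj(p) on the covered locus, every odd `p`: the typed missing input
`MissingPPartAt W p` is EQUIVALENT to the LOWER half `MissingLowerBoundAt W p`** (main-conjecture /
Eisenstein direction). [cite: Kato2004Asterisque, Thm. 14.5 (3) (p. 236)] [cite: Delbourgo1998, Prop. 4 (p. 144)]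
[cite: Miller2011LMS, Def. 1.1] -/
theorem X4RankZero.missingPPartAt_iff_lower_of_facts
    (hKatoS : Kato2004.rankZero_padicValNat_sha_le_sub_localTamagawa_of_additive_potGood_of_imageContainsSL2)
    (hDel : Delbourgo1998.prop4_rankZero_pow_dvd_constantCoeff)
    (hGZK : rank_eq_analyticRank_of_analyticRank_le_one) (hmod : hasEntireLFunction_rat)
    (hmodD : nonempty_modularParametrizationData)
    (hL20 : Wuthrich2014.lemma20_surjective_threeAdic_of_semistable)
    (hKatoχ : Wuthrich2014.kato_halfEigenCharIdeal_dvd_cyclotomicPrime_of_surjective)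
    (hr : W.analyticRank = 0) (hX : ClassX4 W p) (hsurj : Surj W p)
    (hcov : padicValRat p W.j < 0 ∨
      ((∀ n : ℕ, W.HasSurjectiveModNGaloisRep (p ^ n : ℕ)) ∧
        padicValNat p W.tamagawaProduct =
          padicValNat p ((W.baseChange ℚ_[p]).localTamagawaNumber ℤ_[p]) ∧
        ∃ (N : ℕ) (_ : NeZero N) (D : ModularParametrizationData W N), ¬ (p : ℤ) ∣ D.maninConstant)) :
    MissingPPartAt W p ↔ MissingLowerBoundAt W p :=
  ⟨fun h ↦ (lower_and_upper_of_missingPPartAt W p h).1, fun h ↦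
    missingPPartAt_of_lower_of_upper W p h
      (X4RankZero.missingUpperBoundAt_of_facts W p hKatoS hDel hGZK hmod hmodD hL20 hKatoχ hr hX hsurj
        hcov)⟩

/-- **`BSD(E,p)` on the covered locus from the LOWER half alone**, every odd `p`.
[cite: Kato2004Asterisque, Thm. 14.5 (3) (p. 236)] [cite: Delbourgo1998, Prop. 4 (p. 144)]
[cite: Miller2011LMS, §1 and Def. 1.1] -/
theorem X4RankZero.bsdp_of_facts_of_lower
    (hKatoS : Kato2004.rankZero_padicValNat_sha_le_sub_localTamagawa_of_additive_potGood_of_imageContainsSL2)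
    (hDel : Delbourgo1998.prop4_rankZero_pow_dvd_constantCoeff)
    (hGZK : rank_eq_analyticRank_of_analyticRank_le_one) (hmod : hasEntireLFunction_rat)
    (hmodD : nonempty_modularParametrizationData)
    (hL20 : Wuthrich2014.lemma20_surjective_threeAdic_of_semistable)
    (hKatoχ : Wuthrich2014.kato_halfEigenCharIdeal_dvd_cyclotomicPrime_of_surjective)
    (hr : W.analyticRank = 0) (hX : ClassX4 W p) (hsurj : Surj W p)
    (hcov : padicValRat p W.j < 0 ∨
      ((∀ n : ℕ, W.HasSurjectiveModNGaloisRep (p ^ n : ℕ)) ∧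
        padicValNat p W.tamagawaProduct =
          padicValNat p ((W.baseChange ℚ_[p]).localTamagawaNumber ℤ_[p]) ∧
        ∃ (N : ℕ) (_ : NeZero N) (D : ModularParametrizationData W N), ¬ (p : ℤ) ∣ D.maninConstant))
    (hlow : MissingLowerBoundAt W p) : BSDp W p :=
  bsdp_of_missingPPartAt W p hGZK (by rw [hr]; exact zero_le_one)
    ((X4RankZero.missingPPartAt_iff_lower_of_facts W p hKatoS hDel hGZK hmod hmodD hL20 hKatoχ hr hX
      hsurj hcov).mpr hlow)

/-- **THE CHAIN OF RECORD FOR X4 ∧ `r = 0` AT EVERY ODD `p`: `BSD(E,p)` on the covered locus when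
`#Ш_an(E)` is a `p`-unit** — X4 ∧ `r_an = 0` ∧ surj(p) ∧ [`ord_p j < 0` ∨ (tower ∧
`ord_p ∏ c_ℓ = ord_p c_p` ∧ Manin datum)] ∧ `p ∤ #Ш_an` ⟹ `BSD(E,p)`, from five named published
facts + GZK + modularity. At `p = 3` this is `X4RankZero.bsdp_three_of_cert_of_shaAn_unit_sharp`
(tower fed by a `j`-witness / (ram) / surj(9) certificate); at `p ≥ 5` the tower and the local term
are automatic (`…_of_five_le`). [cite: Kato2004Asterisque, Thm. 14.5 (3) (p. 236), Thm. 17.4 (3) (p. 273)]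
[cite: Delbourgo1998, Prop. 4 (p. 144)] [cite: Wuthrich2014, Lemma 20 (p. 399), Cor. 19 (p. 398)]
[cite: Miller2011LMS, §1 and Def. 1.1] -/
theorem X4RankZero.bsdp_of_facts_of_shaAn_unit
    (hKatoS : Kato2004.rankZero_padicValNat_sha_le_sub_localTamagawa_of_additive_potGood_of_imageContainsSL2)
    (hDel : Delbourgo1998.prop4_rankZero_pow_dvd_constantCoeff)
    (hGZK : rank_eq_analyticRank_of_analyticRank_le_one) (hmod : hasEntireLFunction_rat)
    (hmodD : nonempty_modularParametrizationData)
    (hL20 : Wuthrich2014.lemma20_surjective_threeAdic_of_semistable)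
    (hKatoχ : Wuthrich2014.kato_halfEigenCharIdeal_dvd_cyclotomicPrime_of_surjective)
    (hr : W.analyticRank = 0) (hX : ClassX4 W p) (hsurj : Surj W p)
    (hcov : padicValRat p W.j < 0 ∨
      ((∀ n : ℕ, W.HasSurjectiveModNGaloisRep (p ^ n : ℕ)) ∧
        padicValNat p W.tamagawaProduct =
          padicValNat p ((W.baseChange ℚ_[p]).localTamagawaNumber ℤ_[p]) ∧
        ∃ (N : ℕ) (_ : NeZero N) (D : ModularParametrizationData W N), ¬ (p : ℤ) ∣ D.maninConstant))
    {q : ℚ} (hq : shaAn W = (q : ℂ)) (hv : padicValRat p q = 0) : BSDp W p :=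
  bsdp_of_missingPPartAt W p hGZK (by rw [hr]; exact zero_le_one)
    (missingPPartAt_of_upper_of_shaAn_unit W p
      (X4RankZero.missingUpperBoundAt_of_facts W p hKatoS hDel hGZK hmod hmodD hL20 hKatoχ hr hX hsurj
        hcov) hq hv)

/-- The `p ≥ 5` form of the chain of record: X4 ∧ `r_an = 0` ∧ surj(p) ∧
[`ord_p j < 0` ∨ (`p ∤ ∏ c_ℓ` ∧ Manin datum)] ∧ `p ∤ #Ш_an` ⟹ `BSD(E,p)`.
[cite: Kato2004Asterisque, Thm. 14.5 (3) (p. 236)] [cite: Delbourgo1998, Prop. 4 (p. 144)]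
[cite: Miller2011LMS, §1 and Def. 1.1] -/
theorem X4RankZero.bsdp_of_facts_of_shaAn_unit_of_five_le
    (hKatoS : Kato2004.rankZero_padicValNat_sha_le_sub_localTamagawa_of_additive_potGood_of_imageContainsSL2)
    (hDel : Delbourgo1998.prop4_rankZero_pow_dvd_constantCoeff)
    (hGZK : rank_eq_analyticRank_of_analyticRank_le_one) (hmod : hasEntireLFunction_rat)
    (hmodD : nonempty_modularParametrizationData)
    (hL20 : Wuthrich2014.lemma20_surjective_threeAdic_of_semistable)
    (hKatoχ : Wuthrich2014.kato_halfEigenCharIdeal_dvd_cyclotomicPrime_of_surjective)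
    (hp5 : 5 ≤ p) (hr : W.analyticRank = 0) (hX : ClassX4 W p) (hsurj : Surj W p)
    (hcov : padicValRat p W.j < 0 ∨
      (¬ p ∣ W.tamagawaProduct ∧
        ∃ (N : ℕ) (_ : NeZero N) (D : ModularParametrizationData W N), ¬ (p : ℤ) ∣ D.maninConstant))
    {q : ℚ} (hq : shaAn W = (q : ℂ)) (hv : padicValRat p q = 0) : BSDp W p :=
  bsdp_of_missingPPartAt W p hGZK (by rw [hr]; exact zero_le_one)
    (missingPPartAt_of_upper_of_shaAn_unit W p
      (X4RankZero.missingUpperBoundAt_of_facts_of_five_le W p hKatoS hDel hGZK hmod hmodD hL20 hKatoχ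
        hp5 hr hX hsurj hcov) hq hv)

end Summit.BirchSwinnertonDyer.Rank1Residual.Additive

end
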